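import Summits.QuantumFields.YangMills.Theorems.BalabanUVNodesN19KinkLowerBoundLaws
import Summits.QuantumFields.YangMills.Theorems.BalabanUVNodesN19LawPriceJackson

/-!
# YM-DAG node N19 (= NE7 proper) — THE LOWER SIDE OF THE KINK, PART 6: the law-level face for the SINE and on the CUBE —
# probability laws with equal mixed moments of total degree `≤ t` integrating `sin(ωΣ_{i≤d}|x_i|)` differently by `≥ ωd∕(10πt)`

Cell `pub-ymgap`, HUMAN RULING D-0062 (Track A) ∕ D-0149 (work-bound push), R141 (C) wider-strategy seat `pub-ymgap-dag-n19-e` (strategy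
s3 = ALTERNATIVE CURRENCY), generation g31, module 6 (lineage module 137).  Route `Summits/QuantumFields/YangMills/Theses/BalabanUVNodes.lean`,
cluster item K3⁸ «SpineGivenEndpointR13SepCoPHV» (stmt-QuantumFields-27366); filed `--supports` that item `--as helper` (it proves no registered
stub).  COUNT-NEUTRAL: [folklore] over PART 5 `…N19KinkLowerBoundLaws` (`exists_laws_equalMoments_oddPowerSum`) and PART 3
(`abs_sin_sub_oddPowerSum_le`) BY NAME, Mathlib `Measure.map`; TOY laws; no scheme object, no Theses import; NOT a discharge claim.

CONTENT.  §1 `abs_integral_le_of_Icc` (a probability law carried by `[−1,1]` integrates a function bounded by `G` there to at most `G`) ·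
★★ `exists_laws_equalMoments_sin` — for `t ≥ 6` and `0 ≤ a ≤ t∕10`, PART 5's pair `P, Q` (equal moments of order `≤ t`) has
`∫sin(a|x|)dQ − ∫sin(a|x|)dP ≥ a∕(10πt)` (odd-power sum `2a∕(π(9t+6)) ≥ a∕(5πt)`, sine tail `2·2a^{2n₀+2}∕(2n₀+2)! ≤ 4a∕(243t)` as in PART 3,
`1∕(5π) − 4∕243 ≥ 1∕(10π)`).  §2 the cube by the diagonal push-forward `s ↦ (s,…,s)`: `integral_map_diag` · `map_diag_cube_compl` ·
★★★ `exists_laws_equalMixedMoments_sin_l1Norm` — for `t ≥ 6`, `ω ≥ 0`, `ω|ι| ≤ t∕10`: probability laws `P, Q` on `[−1,1]^ι` with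
`∫∏x_i^{j_i}dP = ∫∏x_i^{j_i}dQ` whenever `Σ_i j_i ≤ t` and `∫sin(ωΣ_i|x_i|)dQ − ∫sin(ωΣ_i|x_i|)dP ≥ ω|ι|∕(10πt)` — against module 125's
`|∫sin(ωΣ|x_i|)dP − ∫sin(ωΣ|x_i|)dQ| ≤ 600log₂t(log₂t + 4ω|ι|)∕t` for laws agreeing on `Π_t`: the `W₁`∕equal-moments form of the single-mode row
is TWO-SIDED up to `log²t` on `log₂t ≲ ω|ι| ≤ t∕10`; ★★ `exists_laws_equalMixedMoments_l1Norm` (`Σ_i|x_i|` itself: `≥ 2|ι|∕(π(9t+6))`, all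
`t ≥ 1`).

HONEST FRAMING (binding).  Elementary and [folklore]; TOY laws; NO consumer in the DAG today (an optimality map of the seat's own currency);
nothing of Bałaban's instantiated; NE7 NOT PRINTED, NOT proved; N19 NOT discharged; count-neutral.  One finite `T⁴` programme at fixed `ε`;
nothing continuum ∕ `ℝ⁴` ∕ OS ∕ mass-gap ∕ Clay.  Constants not optimised.  0 `def` ∕ 0 `sorry`.
-/

noncomputable section

open Finset Real MeasureTheory Polynomial

namespace Summit.QuantumFields.YangMills.Theorems.BalabanUVNodesN19KinkLowerBoundLawsCube

open Summit.QuantumFields.YangMills.Theorems.BalabanUVNodesN19SingleModeLowerBound (abs_sin_sub_oddPowerSum_le)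
open Summit.QuantumFields.YangMills.Theorems.BalabanUVNodesN19KinkLowerBoundLaws (exists_laws_equalMoments_oddPowerSum)
open Summit.QuantumFields.YangMills.Theorems.BalabanUVNodesN19LawPriceJackson (integrable_of_continuous_Icc_symm)

/-! ## §1 The sine face on `[−1,1]` [folklore] -/

/-- A probability law carried by `[−1,1]` integrates a function bounded by `G` on `[−1,1]` to at most `G` in absolute value. [bookkeeping] -/
theorem abs_integral_le_of_Icc {P : Measure ℝ} [IsProbabilityMeasure P] (hP : P (Set.Icc (-1 : ℝ) 1)ᶜ = 0) {f : ℝ → ℝ}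
    {G : ℝ} (hG : ∀ x ∈ Set.Icc (-1 : ℝ) 1, |f x| ≤ G) : |∫ x, f x ∂P| ≤ G := by
  have hae : ∀ᵐ x ∂P, x ∈ Set.Icc (-1 : ℝ) 1 := mem_ae_iff.2 hP
  have hbound : ∀ᵐ x ∂P, ‖f x‖ ≤ G := hae.mono fun x hx => by
    rw [Real.norm_eq_abs]
    exact hG x hx
  have h := norm_integral_le_of_norm_le_const hbound
  rwa [probReal_univ, mul_one, Real.norm_eq_abs] at h

/-- ★★ **LAWS AGREEING ON `Π_t`, DISAGREEING ON `sin(a|x|)`.**  For `t ≥ 6` there are probability laws `P, Q` on `[−1,1]` with equal moments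
of order `≤ t` such that `∫sin(a|x|)dQ − ∫sin(a|x|)dP ≥ a∕(10πt)` for every `0 ≤ a ≤ t∕10` (PART 5's pair; the odd-power sum with
`n₀ = ⌊(t−1)∕2⌋` and PART 3's sine tail). [folklore] -/
theorem exists_laws_equalMoments_sin {t : ℕ} (ht : 6 ≤ t) :
    ∃ P Q : Measure ℝ, IsProbabilityMeasure P ∧ IsProbabilityMeasure Q ∧
      P (Set.Icc (-1 : ℝ) 1)ᶜ = 0 ∧ Q (Set.Icc (-1 : ℝ) 1)ᶜ = 0 ∧
      (∀ p : ℝ[X], p.natDegree ≤ t → ∫ x, p.eval x ∂P = ∫ x, p.eval x ∂Q) ∧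
      ∀ a : ℝ, 0 ≤ a → a ≤ t / 10 →
        a / (10 * π * t) ≤ (∫ x, Real.sin (a * |x|) ∂Q) - ∫ x, Real.sin (a * |x|) ∂P := by
  obtain ⟨P, Q, iP, iQ, hPc, hQc, hmom, hodd, -⟩ := exists_laws_equalMoments_oddPowerSum (t := t) (by omega)
  refine ⟨P, Q, iP, iQ, hPc, hQc, hmom, fun a ha hat => ?_⟩
  obtain ⟨n₀, hn₀, hn₀'⟩ : ∃ n₀ : ℕ, 2 * n₀ + 1 ≤ t ∧ t ≤ 2 * n₀ + 2 := ⟨(t - 1) / 2, by omega, by omega⟩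
  have hmain := hodd a n₀ ha hn₀
  have ht6 : (6 : ℝ) ≤ t := by exact_mod_cast ht
  have ht0 : (0 : ℝ) < t := by linarith
  -- the sine tail on `[−1,1]`, pointwise
  set f : ℝ → ℝ := fun x => ∑ k ∈ range (n₀ + 1),
    (-1) ^ k * a ^ (2 * k + 1) / ((2 * k + 1).factorial : ℝ) * |x| ^ (2 * k + 1) with hf
  set n' : ℕ := 2 * n₀ + 1 with hn'
  have hn'5 : (5 : ℝ) ≤ n' := by exact_mod_cast (show 5 ≤ n' by omega)
  have hn't : (t : ℝ) - 1 ≤ n' := by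
    have h' : ((t - 1 : ℕ) : ℝ) = (t : ℝ) - 1 := by rw [Nat.cast_sub (by omega)]; simp
    rw [← h']
    exact_mod_cast (show t - 1 ≤ n' by omega)
  have hn'0 : (0 : ℝ) < n' := by linarith
  have hfac : (n' : ℝ) ^ n' / (n'.factorial : ℝ) ≤ Real.exp 1 ^ n' := by
    have := Real.pow_div_factorial_le_exp (n' : ℝ) (Nat.cast_nonneg n') n'
    rwa [show ((n' : ℕ) : ℝ) = (n' : ℝ) * 1 by ring, Real.exp_nat_mul, mul_one] at this
  have hfac0 : (0 : ℝ) < n'.factorial := by positivity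
  have hr : a * Real.exp 1 / n' ≤ 1 / 3 := by
    rw [div_le_div_iff₀ hn'0 (by norm_num : (0 : ℝ) < 3)]
    have he := Real.exp_one_lt_d9
    nlinarith [Real.exp_pos 1]
  have hr0 : 0 ≤ a * Real.exp 1 / n' := by positivity
  have hpow : a ^ n' / (n'.factorial : ℝ) ≤ (1 / 3 : ℝ) ^ 5 := by
    have h1 : a ^ n' / (n'.factorial : ℝ) ≤ (a * Real.exp 1 / n') ^ n' := by
      rw [div_pow, mul_pow, div_le_div_iff₀ hfac0 (by positivity)]
      have hnn : (n' : ℝ) ^ n' ≤ Real.exp 1 ^ n' * n'.factorial := by rwa [div_le_iff₀ hfac0] at hfac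
      calc a ^ n' * (n' : ℝ) ^ n' ≤ a ^ n' * (Real.exp 1 ^ n' * n'.factorial) :=
            mul_le_mul_of_nonneg_left hnn (pow_nonneg ha _)
        _ = a ^ n' * Real.exp 1 ^ n' * n'.factorial := by ring
    calc a ^ n' / (n'.factorial : ℝ) ≤ (a * Real.exp 1 / n') ^ n' := h1
      _ ≤ (1 / 3 : ℝ) ^ n' := pow_le_pow_left₀ hr0 hr _
      _ ≤ (1 / 3 : ℝ) ^ 5 := pow_le_pow_of_le_one (by norm_num) (by norm_num) (by omega)
  have htail : ∀ x ∈ Set.Icc (-1 : ℝ) 1, |Real.sin (a * |x|) - f x| ≤ 2 * a / (243 * t) := by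
    intro x hx
    have hx1 : |x| ≤ 1 := abs_le.2 ⟨hx.1, hx.2⟩
    have hax : |a * (|x|)| ≤ a := by
      rw [abs_mul, abs_abs, abs_of_nonneg ha]; nlinarith [abs_nonneg x]
    have hax0 : 0 ≤ |a * (|x|)| := abs_nonneg _
    have hy : |a * (|x|)| ≤ (2 * ((n₀ + 1 : ℕ) : ℝ) + 1) / 2 := by
      have h2 : (t : ℝ) ≤ 2 * n₀ + 2 := by exact_mod_cast hn₀'
      push_cast
      nlinarith
    have h := abs_sin_sub_oddPowerSum_le (a * |x|) (n₀ + 1) hy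
    have hsum : ∑ k ∈ range (n₀ + 1), (-1) ^ k * (a * |x|) ^ (2 * k + 1) / ((2 * k + 1).factorial : ℝ) = f x := by
      simp only [hf]
      refine Finset.sum_congr rfl fun k _ => ?_
      rw [mul_pow]
      ring
    rw [hsum] at h
    refine h.trans ?_
    have h2 : 2 * (n₀ + 1) = n' + 1 := by omega
    rw [h2, Nat.factorial_succ, pow_succ]
    push_cast
    have hnum : |a * (|x|)| ^ n' * |a * (|x|)| ≤ a ^ n' * a :=
      mul_le_mul (pow_le_pow_left₀ hax0 hax _) hax hax0 (pow_nonneg ha _)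
    have hn1t : (t : ℝ) ≤ (n' : ℝ) + 1 := by linarith
    calc 2 * (|a * (|x|)| ^ n' * |a * (|x|)|) / (((n' : ℝ) + 1) * n'.factorial)
        ≤ 2 * (a ^ n' * a) / (((n' : ℝ) + 1) * n'.factorial) := by gcongr
      _ = 2 * a * (a ^ n' / n'.factorial) / ((n' : ℝ) + 1) := by field_simp
      _ ≤ 2 * a * (1 / 3 : ℝ) ^ 5 / ((n' : ℝ) + 1) := by gcongr
      _ ≤ 2 * a * (1 / 3 : ℝ) ^ 5 / t := by gcongr
      _ = 2 * a / (243 * t) := by ring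
  -- the tail integrated against `P` and `Q`
  have hfc : Continuous f := by rw [hf]; fun_prop
  have hsfc : Continuous fun x : ℝ => Real.sin (a * |x|) - f x := by rw [hf]; fun_prop
  have hsplit : ∀ (μ : Measure ℝ) [IsProbabilityMeasure μ], μ (Set.Icc (-1 : ℝ) 1)ᶜ = 0 →
      ∫ x, (Real.sin (a * |x|) - f x) ∂μ = (∫ x, Real.sin (a * |x|) ∂μ) - ∫ x, f x ∂μ := by
    intro μ _ hμ
    exact integral_sub (integrable_of_continuous_Icc_symm hμ (by fun_prop)) (integrable_of_continuous_Icc_symm hμ hfc)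
  have hPtail := (abs_le.1 (abs_integral_le_of_Icc hPc htail)).2
  have hQtail := (abs_le.1 (abs_integral_le_of_Icc hQc htail)).1
  have hsP := hsplit P hPc
  have hsQ := hsplit Q hQc
  -- numerics: `A = a/(10πt)`, `B = 2a/(π(9t+6))`, `C = 2a/(243t)`: `2A ≤ B`, `2C ≤ A`
  have hpi := Real.pi_lt_d2
  have hpi0 := Real.pi_pos
  have hstep1 : 2 * (a / (10 * π * t)) ≤ 2 * a / (π * (9 * t + 6)) := by
    rw [show 2 * (a / (10 * π * t)) = 2 * a / (10 * π * t) by ring]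
    exact div_le_div_of_nonneg_left (by positivity) (by positivity) (by nlinarith)
  have hstep2 : 2 * (2 * a / (243 * t)) ≤ a / (10 * π * t) := by
    rw [show 2 * (2 * a / (243 * t)) = 4 * a / (243 * t) by ring, div_le_div_iff₀ (by positivity) (by positivity)]
    have h5 : 0 ≤ a * t * (243 - 40 * π) := mul_nonneg (by positivity) (by nlinarith)
    nlinarith [h5]
  have hkeyQP : 2 * a / (π * (9 * t + 6)) - 2 * a / (243 * t) - 2 * a / (243 * t) ≤
      (∫ x, Real.sin (a * |x|) ∂Q) - ∫ x, Real.sin (a * |x|) ∂P := by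
    rw [hf] at hmain hsP hsQ hPtail hQtail
    linarith
  linarith

/-! ## §2 The cube: the diagonal push-forward [folklore] -/

variable {ι : Type*} [Fintype ι]

omit [Fintype ι] in
/-- The diagonal map `s ↦ (s,…,s)` is measurable. [bookkeeping] -/
theorem measurable_diag : Measurable fun s : ℝ => fun _ : ι => s :=
  measurable_pi_lambda _ fun _ => measurable_id

/-- Integration against the diagonal push-forward `s ↦ (s,…,s)` of a law on `ℝ` (continuous integrand). [bookkeeping] -/
theorem integral_map_diag (P : Measure ℝ) {g : (ι → ℝ) → ℝ} (hg : Continuous g) :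
    ∫ x, g x ∂(P.map fun s : ℝ => fun _ : ι => s) = ∫ s, g (fun _ : ι => s) ∂P :=
  MeasureTheory.integral_map (measurable_diag (ι := ι)).aemeasurable hg.aestronglyMeasurable

/-- The diagonal push-forward of a law carried by `[−1,1]` is carried by the cube `[−1,1]^ι`. [bookkeeping] -/
theorem map_diag_cube_compl {P : Measure ℝ} (hP : P (Set.Icc (-1 : ℝ) 1)ᶜ = 0) :
    (P.map fun s : ℝ => fun _ : ι => s) (Set.pi Set.univ (fun _ : ι => Set.Icc (-1 : ℝ) 1))ᶜ = 0 := by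
  rw [Measure.map_apply (measurable_diag (ι := ι)) (MeasurableSet.univ_pi fun _ => measurableSet_Icc).compl]
  refine measure_mono_null (fun s hs => ?_) hP
  simp only [Set.mem_preimage, Set.mem_compl_iff, Set.mem_univ_pi, not_forall] at hs ⊢
  obtain ⟨_, hi⟩ := hs
  exact hi

omit [Fintype ι] in
/-- The diagonal push-forward of a probability law is a probability law. [bookkeeping] -/
theorem isProbabilityMeasure_map_diag (P : Measure ℝ) [IsProbabilityMeasure P] :
    IsProbabilityMeasure (P.map fun s : ℝ => fun _ : ι => s) :=
  Measure.isProbabilityMeasure_map (measurable_diag (ι := ι)).aemeasurable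

/-- ★★★ **LAWS ON THE CUBE AGREEING ON `Π_t`, DISAGREEING ON THE SINGLE MODE.**  For `t ≥ 6`, `ω ≥ 0` with `ω|ι| ≤ t∕10` there are probability
laws `P, Q` on `[−1,1]^ι` with `∫∏_i x_i^{j_i} dP = ∫∏_i x_i^{j_i} dQ` whenever `Σ_i j_i ≤ t`, and
`∫sin(ωΣ_i|x_i|)dQ − ∫sin(ωΣ_i|x_i|)dP ≥ ω|ι|∕(10πt)` (the diagonal push-forwards of §1's pair). [folklore] -/
theorem exists_laws_equalMixedMoments_sin_l1Norm {t : ℕ} (ht : 6 ≤ t) {ω : ℝ} (hω : 0 ≤ ω)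
    (hωd : ω * Fintype.card ι ≤ t / 10) :
    ∃ P Q : Measure (ι → ℝ), IsProbabilityMeasure P ∧ IsProbabilityMeasure Q ∧
      P (Set.pi Set.univ (fun _ : ι => Set.Icc (-1 : ℝ) 1))ᶜ = 0 ∧ Q (Set.pi Set.univ (fun _ : ι => Set.Icc (-1 : ℝ) 1))ᶜ = 0 ∧
      (∀ j : ι → ℕ, ∑ i, j i ≤ t → ∫ x, ∏ i, x i ^ j i ∂P = ∫ x, ∏ i, x i ^ j i ∂Q) ∧
      ω * Fintype.card ι / (10 * π * t) ≤
        (∫ x, Real.sin (ω * ∑ i, |x i|) ∂Q) - ∫ x, Real.sin (ω * ∑ i, |x i|) ∂P := by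
  obtain ⟨P, Q, iP, iQ, hPc, hQc, hmom, hsin⟩ := exists_laws_equalMoments_sin ht
  refine ⟨P.map fun s : ℝ => fun _ : ι => s, Q.map fun s : ℝ => fun _ : ι => s, isProbabilityMeasure_map_diag P,
    isProbabilityMeasure_map_diag Q, map_diag_cube_compl hPc, map_diag_cube_compl hQc, fun j hj => ?_, ?_⟩
  · have hc : Continuous fun x : ι → ℝ => ∏ i, x i ^ j i := by fun_prop
    rw [integral_map_diag P hc, integral_map_diag Q hc]
    have hpow : ∀ s : ℝ, ∏ i, (fun _ : ι => s) i ^ j i = (Polynomial.X ^ (∑ i, j i) : ℝ[X]).eval s := fun s => by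
      rw [Polynomial.eval_pow, Polynomial.eval_X, Finset.prod_pow_eq_pow_sum]
    simp_rw [hpow]
    exact hmom _ (by rwa [Polynomial.natDegree_X_pow])
  · have hc : Continuous fun x : ι → ℝ => Real.sin (ω * ∑ i, |x i|) := by fun_prop
    rw [integral_map_diag P hc, integral_map_diag Q hc]
    have hsum : ∀ s : ℝ, Real.sin (ω * ∑ _i : ι, |(fun _ : ι => s) _i|) = Real.sin (ω * Fintype.card ι * |s|) := fun s => by
      rw [Finset.sum_const, Finset.card_univ, nsmul_eq_mul, mul_assoc]
    simp_rw [hsum]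
    exact hsin (ω * Fintype.card ι) (mul_nonneg hω (Nat.cast_nonneg _)) hωd

/-- ★★ **LAWS ON THE CUBE AGREEING ON `Π_t`, DISAGREEING ON `Σ_i|x_i|`.**  For `t ≥ 1` there are probability laws `P, Q` on `[−1,1]^ι` with
equal mixed moments of total degree `≤ t` and `∫Σ_i|x_i| dQ − ∫Σ_i|x_i| dP ≥ 2|ι|∕(π(9t+6))`. [folklore] -/
theorem exists_laws_equalMixedMoments_l1Norm {t : ℕ} (ht : 1 ≤ t) :
    ∃ P Q : Measure (ι → ℝ), IsProbabilityMeasure P ∧ IsProbabilityMeasure Q ∧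
      P (Set.pi Set.univ (fun _ : ι => Set.Icc (-1 : ℝ) 1))ᶜ = 0 ∧ Q (Set.pi Set.univ (fun _ : ι => Set.Icc (-1 : ℝ) 1))ᶜ = 0 ∧
      (∀ j : ι → ℕ, ∑ i, j i ≤ t → ∫ x, ∏ i, x i ^ j i ∂P = ∫ x, ∏ i, x i ^ j i ∂Q) ∧
      2 * Fintype.card ι / (π * (9 * t + 6)) ≤ (∫ x, ∑ i, |x i| ∂Q) - ∫ x, ∑ i, |x i| ∂P := by
  obtain ⟨P, Q, iP, iQ, hPc, hQc, hmom, hodd, -⟩ := exists_laws_equalMoments_oddPowerSum ht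
  refine ⟨P.map fun s : ℝ => fun _ : ι => s, Q.map fun s : ℝ => fun _ : ι => s, isProbabilityMeasure_map_diag P,
    isProbabilityMeasure_map_diag Q, map_diag_cube_compl hPc, map_diag_cube_compl hQc, fun j hj => ?_, ?_⟩
  · have hc : Continuous fun x : ι → ℝ => ∏ i, x i ^ j i := by fun_prop
    rw [integral_map_diag P hc, integral_map_diag Q hc]
    have hpow : ∀ s : ℝ, ∏ i, (fun _ : ι => s) i ^ j i = (Polynomial.X ^ (∑ i, j i) : ℝ[X]).eval s := fun s => by
      rw [Polynomial.eval_pow, Polynomial.eval_X, Finset.prod_pow_eq_pow_sum]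
    simp_rw [hpow]
    exact hmom _ (by rwa [Polynomial.natDegree_X_pow])
  · have hc : Continuous fun x : ι → ℝ => ∑ i, |x i| := by fun_prop
    rw [integral_map_diag P hc, integral_map_diag Q hc]
    have h := hodd (Fintype.card ι) 0 (Nat.cast_nonneg _) (by omega)
    simp only [Finset.sum_range_one, pow_zero, Nat.mul_zero, zero_add, pow_one, Nat.factorial_one, Nat.cast_one,
      div_one, one_mul] at h
    have hsum : ∀ s : ℝ, ∑ _i : ι, |(fun _ : ι => s) _i| = Fintype.card ι * |s| := fun s => by
      rw [Finset.sum_const, Finset.card_univ, nsmul_eq_mul]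
    simp_rw [hsum]
    exact h

end Summit.QuantumFields.YangMills.Theorems.BalabanUVNodesN19KinkLowerBoundLawsCube

end
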